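import Summits.RiemannHypothesis.RiemannHypothesis.Theorems.GroundBartaEvenWinsBeyondArchDeflationMarkovY
import Summits.RiemannHypothesis.RiemannHypothesis.Theorems.GroundBartaEvenWinsBeyondArchDeflationPoleY
import Summits.RiemannHypothesis.RiemannHypothesis.Theorems.GroundBartaEvenWinsBeyondArchDeflationALayerY
import Summits.RiemannHypothesis.RiemannHypothesis.Theorems.GroundBartaEvenWinsBeyondArchDeflationM78Common
import Summits.RiemannHypothesis.RiemannHypothesis.Theorems.GroundBartaEvenWinsBeyondArchDeflationEndpointCF
import HarnessLib

/-!
# RiemannHypothesis / GroundBarta — rung 4 (`EvenWinsBeyondArch`, stmt-RiemannHypothesis-18807 / 18085):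
# the deflated Temple L-side at the endpoint-cell cut `c' = 2759087199219/3428634528742` — shared kernel checks of the A-layer

Helper file (`--supports stmt-RiemannHypothesis-18085`), RH-free, no named facts.  Prover B (gen 6 of unit `sr-gb-rung-b`), after
prover A's per-cell `…Common` template (speedrun unit `sr-gb-rung-a`).

The pieces of the A-layer certificates that depend only on the window `b = c'` of the ENDPOINT CELL `(log 5)/2` (trial vectors of both
parities are cut at `c'`, `(log 5)/2 − c' ≈ 2.1·10⁻²⁶`): the window lies in the `{2,3,4}`-range (`n25_log2_lt`, `n25_le_log5` — the latter
from the kernel enclosure of `log 5`, `…EndpointCF`), the pole check (`n25_poleCheck`) at scale `S = 2¹¹⁰`, and the two-sided literal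
enclosure of the killing constant (`n25_markov_mem`, from the window-independent `m78_markovCheck` / `m78_markov_vals`).
-/

set_option linter.dupNamespace false

noncomputable section

namespace Summit.RiemannHypothesis.RiemannHypothesis.Theorems.EvenWinsBeyondArch

open Literature.NumberTheory.LFunctions

/-- `log 2 < c'`. [folklore] -/
theorem n25_log2_lt : Real.log 2 < (((2759087199219 / 3428634528742 : ℚ)) : ℝ) := by
  have h := dt_cf_log2_lt_cut; push_cast at h ⊢; linarith

/-- `c' ≤ (log 5)/2`. [folklore] -/
theorem n25_le_log5 : (((2759087199219 / 3428634528742 : ℚ)) : ℝ) ≤ Real.log 5 / 2 := by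
  have h := dt_cf_cut_lt_log5half; push_cast at h ⊢; linarith

set_option maxHeartbeats 0 in
/-- The pole check at `b = c'` (exponential enclosures succeed). [folklore] -/
theorem n25_poleCheck : poleCheckY (2 ^ 110) 20 4 (2759087199219 / 3428634528742) = true := by
  decide +kernel

/-- **`8.314156944449285937 ≤ M_{c'} ≤ 8.314156944449293738`.** [folklore] -/
theorem n25_markov_mem :
    (8314156944449285937 / 1000000000000000000 : ℝ) ≤
        weilMarkovConstant (((2759087199219 / 3428634528742 : ℚ)) : ℝ) ∧
      weilMarkovConstant (((2759087199219 / 3428634528742 : ℚ)) : ℝ) ≤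
        (4157078472224646869 / 500000000000000000 : ℝ) := by
  have h := dt_weilMarkovConstant_mem n25_log2_lt n25_le_log5 (S := 2 ^ 110) (by norm_num) m78_markovCheck
  obtain ⟨v1, v2⟩ := m78_markov_vals
  have hS : (0 : ℝ) < ((2 ^ 110 : ℕ) : ℝ) := by positivity
  have v1r := (Rat.cast_le (K := ℝ)).2 v1
  have v2r := (Rat.cast_le (K := ℝ)).2 v2
  push_cast at v1r v2r
  obtain ⟨h1, h2⟩ := h
  rw [div_le_iff₀ hS] at h1
  rw [le_div_iff₀ hS] at h2
  constructor <;> nlinarith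

end Summit.RiemannHypothesis.RiemannHypothesis.Theorems.EvenWinsBeyondArch

end
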